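import Summits.QuantumFields.YangMills.Theorems.SwapVirialDeficitBlowUpGnomonicStratumBSeamJointCoords
import Summits.QuantumFields.YangMills.Theorems.SwapVirialDeficitBlowUpGnomonicStratumBJoint
import Summits.QuantumFields.YangMills.Theorems.SwapVirialDeficitBlowUpGnomonicStratumBDiagonal
import HarnessLib

/-!
# THE DIAGONAL JOINT B-FIBRE FLOOR: `k_δδ² + k_x|u|²x₀′² + k_y(…) + |z′|²/(12150L⁶) + k_FΣ|η_f′|² ≤ (d²/ds²)F̂(a − (sδ)·1, ε, η_B + s·ξ_B(d))|₀` — ALL of fibre_B in ONE inequality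
# (free-hands support of ⟨stmt-QuantumFields-24197⟩ `SwapVirialDeficit.SwapGluedStiffness`; stub (S-B) `stub_B_stiff` of LEAD g98's plan of record — ✓`fibre_raySecond_ge_stratumB_joint` ⊕
# ✓`fibre_raySecond_ge_stratumB_seam_joint_coords` with the `z′`∕`δ`-coupling square dropped and the `z′`-coupling of the `x₀′`-square absorbed, weights `109/110 ∕ 1/110`)

* ★★★ `fibre_raySecond_ge_stratumB_joint_diag (ha : a.im ≠ 0) (hre) (ε) (hz) (hε) (u₁ u₂ δ d)`:
  `|u|²·x₀′²/(12375L⁶(1+|u|²)²) + (109/165)·[((4δ²/‖im a‖²)·4|u|²/(1+|u|²) + 4(y₁′²+y₂′²))/16200L⁶ + 2Σ_f|η_f′|²/(2304L⁶|Fol L|) + ((u₁y₂′−u₂y₁′)² + (u₂y₀′)² + (u₁y₀′)²)/(450L⁶(1+|u|²))]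
   + |z′|²/(12150L⁶) ≤ (d²/ds²)F̂(a − (sδ)·1, ε, η_B + s·ξ_B(d))|₀`.
So on a B-tube (`u ≠ 0`) the WHOLE fibre_B = (δ, x₀′, y′, z′, η_F′) is stiff along every joint ray with DIAGONAL coefficients `≳ |u|²/((1+|u|²)²P(L))` (δ: `∝ |u|²/((1+|u|²)‖a‖²)`),
degenerating exactly on `Σ = {u = 0}` — the input shape of w2's «δ-in-fibre fibred lemma» for `stub_B_stiff` (LEAD memo7 §E(3)).

HONEST LABEL: arithmetic on landed floors; regions' stiffness, ⟨24197⟩ ∕ ⟨24194⟩ ∕ ⟨24497⟩ OPEN; own crux ⟨22884⟩ OPEN (blocked-on ⟨19935⟩); the Yang–Mills mass gap is NOT proved;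
no summit is proved by a line.  THEOREMS ONLY (0 `def`, 0 `sorry`), standard axioms.  Width seat ym-line-sfw-p2-w3 g66 (cell ym-idea-1, free hands),
`--supports stmt-QuantumFields-24197`.  References: [cite: Luscher1983, §2]; [folklore].
-/

set_option autoImplicit false

noncomputable section

open MeasureTheory Quaternion
open scoped BigOperators Quaternion
open Literature.MathematicalPhysics.QuantumFieldTheory hiding SU2
open Literature.MathematicalPhysics.QuantumLattice

namespace Summit.QuantumFields.YangMills.Theorems.SwapVirialDeficit.BlowUpRing

open Summit.QuantumFields.YangMills.Theorems.FemtoTransferGap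
open Summit.QuantumFields.YangMills.Theorems.SwapVirialDeficit.Gnomonic (normSq3 normSq3_nonneg)

variable {L : ℕ} [NeZero L]

set_option maxHeartbeats 800000 in
/-- ★★★ **THE DIAGONAL JOINT B-FIBRE FLOOR** (end hub `im a ≠ 0`, `re a = 0`; `ε_z = +`, followers `+`; hub speed `δ`, letter direction `d`). [cite: Luscher1983, §2] -/
theorem fibre_raySecond_ge_stratumB_joint_diag {a : ℍ} (ha : a.im ≠ 0) (hre : a.re = 0) (ε : GnoSign L) (hz : ε.2.1 = true) (hε : ε.2.2 = fun _ => true)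
    (u₁ u₂ δ : ℝ) (d : ℝ × (Fin 3 → ℝ) × (Fin 3 → ℝ) × (Fol L → Fin 3 → ℝ)) :
    (u₁ ^ 2 + u₂ ^ 2) * d.1 ^ 2 / (12375 * (L : ℝ) ^ 6 * (1 + (u₁ ^ 2 + u₂ ^ 2)) ^ 2) +
        109 / 165 * (((4 * δ ^ 2 / ‖a.im‖ ^ 2) * (4 * (u₁ ^ 2 + u₂ ^ 2) / (1 + (u₁ ^ 2 + u₂ ^ 2))) + 4 * (d.2.1 1 ^ 2 + d.2.1 2 ^ 2)) / (16200 * (L : ℝ) ^ 6) +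
          (∑ f, 2 * normSq3 (d.2.2.2 f)) / (2304 * (L : ℝ) ^ 6 * (Fintype.card (Fol L) : ℝ)) +
          ((u₁ * d.2.1 2 - u₂ * d.2.1 1) ^ 2 + (u₂ * d.2.1 0) ^ 2 + (u₁ * d.2.1 0) ^ 2) / (450 * (L : ℝ) ^ 6 * (1 + (u₁ ^ 2 + u₂ ^ 2)))) +
        normSq3 d.2.2.1 / (12150 * (L : ℝ) ^ 6) ≤
      iteratedDeriv 2 (fun s : ℝ => gnoDeficit (fun _ => false) (fun _ => 1) (a - (s * δ) • (1 : ℍ)) ε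
        (((((![0, u₁, u₂] : Fin 3 → ℝ), (0 : Fin 3 → ℝ)), ((0 : Fin 3 → ℝ), (0 : Fol L → Fin 3 → ℝ))) : GnoCoord L) +
          s • ((((![d.1, 0, 0] : Fin 3 → ℝ), d.2.1), (d.2.2.1, d.2.2.2)) : GnoCoord L))) 0 := by
  have hL : (0 : ℝ) < L := by exact_mod_cast NeZero.pos L
  have h1 := fibre_raySecond_ge_stratumB_joint (L := L) ha hre ε hz hε u₁ u₂ δ d
  have h2 := fibre_raySecond_ge_stratumB_seam_joint_coords (L := L) ha hre ε hz hε u₁ u₂ δ d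
  obtain ⟨Q, hQ⟩ : ∃ Q : ℝ, Q = iteratedDeriv 2 (fun s : ℝ => gnoDeficit (fun _ => false) (fun _ => 1) (a - (s * δ) • (1 : ℍ)) ε
        (((((![0, u₁, u₂] : Fin 3 → ℝ), (0 : Fin 3 → ℝ)), ((0 : Fin 3 → ℝ), (0 : Fol L → Fin 3 → ℝ))) : GnoCoord L) +
          s • ((((![d.1, 0, 0] : Fin 3 → ℝ), d.2.1), (d.2.2.1, d.2.2.2)) : GnoCoord L))) 0 := ⟨_, rfl⟩
  rw [← hQ] at h1 h2 ⊢
  -- scalar names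
  obtain ⟨U, hU⟩ : ∃ t : ℝ, t = u₁ ^ 2 + u₂ ^ 2 := ⟨_, rfl⟩
  obtain ⟨Nz, hNz⟩ : ∃ t : ℝ, t = normSq3 d.2.2.1 := ⟨_, rfl⟩
  obtain ⟨q, hq⟩ : ∃ t : ℝ, t = d.2.2.1 0 + (u₂ * d.2.2.1 1 - u₁ * d.2.2.1 2) := ⟨_, rfl⟩
  have hU0 : 0 ≤ U := by rw [hU]; positivity
  have hNz0 : 0 ≤ Nz := by rw [hNz]; exact normSq3_nonneg _
  have hq2 : q ^ 2 ≤ 2 * (1 + U) * Nz := by rw [hq, hU, hNz]; exact coupling_sq_le u₁ u₂ d.2.2.1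
  -- weaken the seam floor: drop the first square, open the second
  have hD : (0 : ℝ) < 225 * (L : ℝ) ^ 6 * (1 + U) ^ 2 := by positivity
  have hsq : 2 * d.1 ^ 2 - q ^ 2 ≤ (2 * d.1 + q) ^ 2 := by nlinarith [sq_nonneg (2 * d.1 + 2 * q)]
  have hnum : U * (2 * d.1 ^ 2 - 2 * (1 + U) * Nz) ≤
      (U * (d.2.2.1 0 + 2 * δ / ‖a‖) - (u₂ * d.2.2.1 1 - u₁ * d.2.2.1 2)) ^ 2 + U * (2 * d.1 + d.2.2.1 0 + (u₂ * d.2.2.1 1 - u₁ * d.2.2.1 2)) ^ 2 := by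
    have e : 2 * d.1 + d.2.2.1 0 + (u₂ * d.2.2.1 1 - u₁ * d.2.2.1 2) = 2 * d.1 + q := by rw [hq]; ring
    rw [e]
    nlinarith [sq_nonneg (U * (d.2.2.1 0 + 2 * δ / ‖a‖) - (u₂ * d.2.2.1 1 - u₁ * d.2.2.1 2)), mul_le_mul_of_nonneg_left hsq hU0,
      mul_le_mul_of_nonneg_left hq2 hU0]
  have h2' : U * (2 * d.1 ^ 2 - 2 * (1 + U) * Nz) / (225 * (L : ℝ) ^ 6 * (1 + U) ^ 2) ≤ Q := by
    have h2u : ((U * (d.2.2.1 0 + 2 * δ / ‖a‖) - (u₂ * d.2.2.1 1 - u₁ * d.2.2.1 2)) ^ 2 + U * (2 * d.1 + d.2.2.1 0 + (u₂ * d.2.2.1 1 - u₁ * d.2.2.1 2)) ^ 2) /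
        (225 * (L : ℝ) ^ 6 * (1 + U) ^ 2) ≤ Q := by rw [hU]; exact h2
    exact le_trans (div_le_div_of_nonneg_right hnum hD.le) h2u
  -- split and bound the `z` part of the weakened seam floor
  have hsplit : U * (2 * d.1 ^ 2 - 2 * (1 + U) * Nz) / (225 * (L : ℝ) ^ 6 * (1 + U) ^ 2) =
      2 * U * d.1 ^ 2 / (225 * (L : ℝ) ^ 6 * (1 + U) ^ 2) - U / (1 + U) * (2 * Nz / (225 * (L : ℝ) ^ 6)) := by
    have h1U : (1 + U) ≠ 0 := by positivity
    have hL6 : (L : ℝ) ^ 6 ≠ 0 := by positivity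
    field_simp
  have hfrac : U / (1 + U) ≤ 1 := by rw [div_le_one (by positivity)]; linarith only [hU0]
  have hZpart : U / (1 + U) * (2 * Nz / (225 * (L : ℝ) ^ 6)) ≤ 2 * Nz / (225 * (L : ℝ) ^ 6) := by
    have hz' : 0 ≤ 2 * Nz / (225 * (L : ℝ) ^ 6) := by positivity
    calc U / (1 + U) * (2 * Nz / (225 * (L : ℝ) ^ 6)) ≤ 1 * (2 * Nz / (225 * (L : ℝ) ^ 6)) := mul_le_mul_of_nonneg_right hfrac hz'
      _ = 2 * Nz / (225 * (L : ℝ) ^ 6) := one_mul _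
  rw [hsplit] at h2'
  -- the η-floor with the names
  have h1' : 2 / 3 * (((((4 * δ ^ 2 / ‖a.im‖ ^ 2) * (4 * U / (1 + U)) + 4 * (d.2.1 1 ^ 2 + d.2.1 2 ^ 2)) + 4 * Nz) / (16200 * (L : ℝ) ^ 6)) +
      (∑ f, 2 * normSq3 (d.2.2.2 f)) / (2304 * (L : ℝ) ^ 6 * (Fintype.card (Fol L) : ℝ)) +
      ((u₁ * d.2.1 2 - u₂ * d.2.1 1) ^ 2 + (u₂ * d.2.1 0) ^ 2 + (u₁ * d.2.1 0) ^ 2) / (450 * (L : ℝ) ^ 6 * (1 + U))) ≤ Q := by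
    rw [hNz, hU]; exact h1
  -- combine with weights `109/110` and `1/110`
  have hcomb : 109 / 110 * (2 / 3 * (((((4 * δ ^ 2 / ‖a.im‖ ^ 2) * (4 * U / (1 + U)) + 4 * (d.2.1 1 ^ 2 + d.2.1 2 ^ 2)) + 4 * Nz) / (16200 * (L : ℝ) ^ 6)) +
      (∑ f, 2 * normSq3 (d.2.2.2 f)) / (2304 * (L : ℝ) ^ 6 * (Fintype.card (Fol L) : ℝ)) +
      ((u₁ * d.2.1 2 - u₂ * d.2.1 1) ^ 2 + (u₂ * d.2.1 0) ^ 2 + (u₁ * d.2.1 0) ^ 2) / (450 * (L : ℝ) ^ 6 * (1 + U)))) +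
      1 / 110 * (2 * U * d.1 ^ 2 / (225 * (L : ℝ) ^ 6 * (1 + U) ^ 2) - U / (1 + U) * (2 * Nz / (225 * (L : ℝ) ^ 6))) ≤ Q := by
    linarith only [h1', h2']
  -- identify the target's coefficients
  rw [← hU, ← hNz]
  have eX : U * d.1 ^ 2 / (12375 * (L : ℝ) ^ 6 * (1 + U) ^ 2) = 1 / 110 * (2 * U * d.1 ^ 2 / (225 * (L : ℝ) ^ 6 * (1 + U) ^ 2)) := by
    have hd1 : (12375 * (L : ℝ) ^ 6 * (1 + U) ^ 2) ≠ 0 := by positivity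
    have hd2 : (225 * (L : ℝ) ^ 6 * (1 + U) ^ 2) ≠ 0 := by positivity
    rw [mul_div_assoc', div_eq_div_iff hd1 hd2]
    ring
  have eZ : Nz / (12150 * (L : ℝ) ^ 6) = 109 / 110 * (2 / 3 * (4 * Nz / (16200 * (L : ℝ) ^ 6))) - 1 / 110 * (2 * Nz / (225 * (L : ℝ) ^ 6)) := by
    have hL6 : (L : ℝ) ^ 6 ≠ 0 := by positivity
    field_simp
    ring
  have eH : 109 / 165 * (((4 * δ ^ 2 / ‖a.im‖ ^ 2) * (4 * U / (1 + U)) + 4 * (d.2.1 1 ^ 2 + d.2.1 2 ^ 2)) / (16200 * (L : ℝ) ^ 6) +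
      (∑ f, 2 * normSq3 (d.2.2.2 f)) / (2304 * (L : ℝ) ^ 6 * (Fintype.card (Fol L) : ℝ)) +
      ((u₁ * d.2.1 2 - u₂ * d.2.1 1) ^ 2 + (u₂ * d.2.1 0) ^ 2 + (u₁ * d.2.1 0) ^ 2) / (450 * (L : ℝ) ^ 6 * (1 + U))) +
      109 / 110 * (2 / 3 * (4 * Nz / (16200 * (L : ℝ) ^ 6))) =
      109 / 110 * (2 / 3 * (((((4 * δ ^ 2 / ‖a.im‖ ^ 2) * (4 * U / (1 + U)) + 4 * (d.2.1 1 ^ 2 + d.2.1 2 ^ 2)) + 4 * Nz) / (16200 * (L : ℝ) ^ 6)) +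
      (∑ f, 2 * normSq3 (d.2.2.2 f)) / (2304 * (L : ℝ) ^ 6 * (Fintype.card (Fol L) : ℝ)) +
      ((u₁ * d.2.1 2 - u₂ * d.2.1 1) ^ 2 + (u₂ * d.2.1 0) ^ 2 + (u₁ * d.2.1 0) ^ 2) / (450 * (L : ℝ) ^ 6 * (1 + U)))) := by
    ring
  rw [eX, eZ]
  linarith only [hcomb, hZpart, eH]

end Summit.QuantumFields.YangMills.Theorems.SwapVirialDeficit.BlowUpRing

end
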